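import Summits.QuantumFields.QCD.Theorems.QuarksAsStableActionCriticalLineDiamagnetismRectFreqOpTransfer
import Summits.QuantumFields.QCD.Theorems.QuarksAsStableActionCriticalLineDiamagnetismPressure

/-!
# Route B helper `freeGap` of line `Sketch`: the spectral gap of the one-step transfer matrix at a heavy frequency
(crux `Summit.QuantumFields.QCD.Theses.QuarksAsStableAction.CriticalLineDiamagnetism`, item stmt-QuantumFields-9734,
static route for odd tori, Route B of the heavy-frequency gain)

Lüscher's dressed one-step matrix `M = (1 + P⁺CP⁻)(B̂P⁺ + B̂⁻¹P⁻)(1 − P⁻CP⁺)` of a row of the rectangular frequency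
operator (`FrequencyDiamagnetism.oneStepR`) has the explicit inverse `N = (1 + P⁻CP⁺)(B̂P⁻ + B̂⁻¹P⁺)(1 − P⁺CP⁻)`
(the dressings are unipotent, `(P⁺CP⁻)² = 0`), and
`M + N = B̂ + Y(B̂⁻¹P⁻)Yᴴ + Y′(B̂⁻¹P⁺)Y′ᴴ ⪰ B̂ ⪰ (M_ω − 1)·1`
(`Y = 1 + P⁺CP⁻`, `Y′ = 1 + P⁻CP⁺`; `B̂ = B ⊗ 1`, `B = M_ω·1 − ½(H + Hᴴ) = (M_ω − 1)·1 + ½(1 − H)ᴴ(1 − H)` with the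
isometric hop `H`, `M_ω = m + 4 − cos ω₀ − cos ω₁`).  Hence every eigenvalue `μ` of the positive matrix `M` satisfies
`μ + 1/μ ≥ M_ω − 1`, which is `≥ 17/4` at a heavy frequency (`cos ω₀, cos ω₁ ≤ −199/200`, `|m| ≤ 1/10`), i.e.
`μ ∉ (1/4, 4)`; with `det(1 + M^k) = ∏ (1 + μᵢ^k)` (`det_one_add_pow_eq`) and `log(1 + x) ≤ x` this gives the
finite-length pressure bound `log det(1 + M^k) ≤ k Σᵢ log max(μᵢ, 1) + 12 L₂ (1/4)^k` (registered stub `freeGap`,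
stated for the free row; the gap `oneStepR_eigenvalue_gap` holds for every row of every field).
-/

noncomputable section

open scoped BigOperators Matrix ComplexConjugate Kronecker ComplexOrder
open Finset
open Literature.MathematicalPhysics.QuantumLattice Literature.MathematicalPhysics.QuantumFieldTheory
  Literature.Probability.LatticeModels

namespace Summit.QuantumFields.QCD.Cruxes.CriticalLineDiamagnetism.ChessboardCellGain

namespace FreeGap

open Matrix Complex
open Summit.QuantumFields.QCD.Cruxes.StableActionBridge.Sketch
open FrequencyDiamagnetism

/-! ### Abstract part: the dressed core, its explicit inverse and the operator bound `M + M⁻¹ ⪰ B̂` -/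

section Abstract

variable {n : Type*} [Fintype n] [DecidableEq n]

/-- One-sided collapse of the dressings: if `u X = 0 = X v` then `(1 + u)(X + K)(1 − v) = X + (1 + u)K(1 − v)`. -/
theorem dress_collapse (u v X K : Matrix n n ℂ) (h1 : u * X = 0) (h2 : X * v = 0) :
    (1 + u) * (X + K) * (1 - v) = X + (1 + u) * K * (1 - v) := by
  have hX : (1 + u) * X * (1 - v) = X := by
    rw [add_mul, one_mul, h1, add_zero, mul_sub, mul_one, h2, sub_zero]
  rw [mul_add, add_mul, hX]

/-- A square-zero `x` gives `(1 − x)(1 + x) = 1`. -/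
theorem one_sub_mul_one_add {x : Matrix n n ℂ} (hx : x * x = 0) : (1 - x) * (1 + x) = 1 := by
  rw [sub_mul, one_mul, mul_add, mul_one, hx, add_zero, add_sub_cancel_right]

/-- A square-zero `x` gives `(1 + x)(1 − x) = 1`. -/
theorem one_add_mul_one_sub {x : Matrix n n ℂ} (hx : x * x = 0) : (1 + x) * (1 - x) = 1 := by
  rw [add_mul, one_mul, mul_sub, mul_one, hx, sub_zero, sub_add_cancel]

variable {Pp Pm B C : Matrix n n ℂ}

omit [DecidableEq n] in
/-- `(P⁺ C P⁻)² = 0` (`P⁻ P⁺ = 0`). -/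
theorem dressing_sq (C : Matrix n n ℂ) (hPmPp : Pm * Pp = 0) : Pp * C * Pm * (Pp * C * Pm) = 0 := by
  calc Pp * C * Pm * (Pp * C * Pm) = Pp * C * (Pm * Pp) * C * Pm := by simp only [Matrix.mul_assoc]
    _ = 0 := by rw [hPmPp, Matrix.mul_zero, Matrix.zero_mul, Matrix.zero_mul]

omit [DecidableEq n] in
/-- `P⁺ C P⁻ · (B P⁺) = 0` when `B` commutes with `P⁻` and `P⁻ P⁺ = 0`. -/
theorem dressing_mul_kernel (C : Matrix n n ℂ) (hBPm : B * Pm = Pm * B) (hPmPp : Pm * Pp = 0) :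
    Pp * C * Pm * (B * Pp) = 0 := by
  calc Pp * C * Pm * (B * Pp) = Pp * C * (Pm * B) * Pp := by simp only [Matrix.mul_assoc]
    _ = Pp * C * B * (Pm * Pp) := by rw [← hBPm]; simp only [Matrix.mul_assoc]
    _ = 0 := by rw [hPmPp, Matrix.mul_zero]

omit [DecidableEq n] in
/-- `(B P⁺) · P⁻ C P⁺ = 0` when `P⁺ P⁻ = 0`. -/
theorem kernel_mul_dressing (B C : Matrix n n ℂ) (hPpPm : Pp * Pm = 0) : B * Pp * (Pm * C * Pp) = 0 := by
  calc B * Pp * (Pm * C * Pp) = B * (Pp * Pm) * C * Pp := by simp only [Matrix.mul_assoc]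
    _ = 0 := by rw [hPpPm, Matrix.mul_zero, Matrix.zero_mul, Matrix.zero_mul]

/-- **The two kernels are inverse to each other**: `(B P⁻ + B⁻¹ P⁺)(B P⁺ + B⁻¹ P⁻) = 1`. -/
theorem kernel'_mul_kernel (hB : IsUnit B.det) (hsum : Pp + Pm = 1) (hPp2 : Pp * Pp = Pp) (hPm2 : Pm * Pm = Pm)
    (hPpPm : Pp * Pm = 0) (hPmPp : Pm * Pp = 0) (hBPp : B * Pp = Pp * B) (hBPm : B * Pm = Pm * B) :
    (B * Pm + B⁻¹ * Pp) * (B * Pp + B⁻¹ * Pm) = 1 := by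
  have hB'Pp : B⁻¹ * Pp = Pp * B⁻¹ := DressedCorePosDef.inv_mul_comm_of_mul_comm hB hBPp
  have hB'Pm : B⁻¹ * Pm = Pm * B⁻¹ := DressedCorePosDef.inv_mul_comm_of_mul_comm hB hBPm
  have e1 : B * Pm * (B * Pp) = 0 := by
    calc B * Pm * (B * Pp) = B * (Pm * B) * Pp := by simp only [Matrix.mul_assoc]
      _ = B * B * (Pm * Pp) := by rw [← hBPm]; simp only [Matrix.mul_assoc]
      _ = 0 := by rw [hPmPp, Matrix.mul_zero]
  have e2 : B * Pm * (B⁻¹ * Pm) = Pm := by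
    calc B * Pm * (B⁻¹ * Pm) = B * (Pm * B⁻¹) * Pm := by simp only [Matrix.mul_assoc]
      _ = B * B⁻¹ * (Pm * Pm) := by rw [← hB'Pm]; simp only [Matrix.mul_assoc]
      _ = Pm := by rw [Matrix.mul_nonsing_inv _ hB, Matrix.one_mul, hPm2]
  have e3 : B⁻¹ * Pp * (B * Pp) = Pp := by
    calc B⁻¹ * Pp * (B * Pp) = B⁻¹ * (Pp * B) * Pp := by simp only [Matrix.mul_assoc]
      _ = B⁻¹ * B * (Pp * Pp) := by rw [← hBPp]; simp only [Matrix.mul_assoc]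
      _ = Pp := by rw [Matrix.nonsing_inv_mul _ hB, Matrix.one_mul, hPp2]
  have e4 : B⁻¹ * Pp * (B⁻¹ * Pm) = 0 := by
    calc B⁻¹ * Pp * (B⁻¹ * Pm) = B⁻¹ * (Pp * B⁻¹) * Pm := by simp only [Matrix.mul_assoc]
      _ = B⁻¹ * B⁻¹ * (Pp * Pm) := by rw [← hB'Pp]; simp only [Matrix.mul_assoc]
      _ = 0 := by rw [hPpPm, Matrix.mul_zero]
  rw [add_mul, mul_add, mul_add, e1, e2, e3, e4, zero_add, add_zero, add_comm, hsum]

/-- **The core splits off `B P⁺`**: `M = B P⁺ + (1 + P⁺CP⁻)(B⁻¹P⁻)(1 − P⁻CP⁺)`. -/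
theorem core_eq (C : Matrix n n ℂ) (hPpPm : Pp * Pm = 0) (hPmPp : Pm * Pp = 0) (hBPm : B * Pm = Pm * B) :
    (1 + Pp * C * Pm) * (B * Pp + B⁻¹ * Pm) * (1 - Pm * C * Pp) =
      B * Pp + (1 + Pp * C * Pm) * (B⁻¹ * Pm) * (1 - Pm * C * Pp) :=
  dress_collapse _ _ _ _ (dressing_mul_kernel C hBPm hPmPp) (kernel_mul_dressing B C hPpPm)

/-- **The tail is a congruence of a positive matrix**: `(1 + P⁺CP⁻)(B⁻¹P⁻)(1 − P⁻CP⁺) = Y (B⁻¹P⁻) Yᴴ ⪰ 0`. -/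
theorem tail_posSemidef (hPm2 : Pm * Pm = Pm) (hPpH : Pp.IsHermitian) (hPmH : Pm.IsHermitian)
    (hBPm : B * Pm = Pm * B) (hC : Cᴴ = -C) (hB : B.PosDef) :
    ((1 + Pp * C * Pm) * (B⁻¹ * Pm) * (1 - Pm * C * Pp)).PosSemidef := by
  have hdet : IsUnit B.det := (Matrix.isUnit_iff_isUnit_det B).mp hB.isUnit
  have hK : (B⁻¹ * Pm).PosSemidef := DressedCorePosDef.posSemidef_mul_proj hB.inv.posSemidef hPm2 hPmH
    (DressedCorePosDef.inv_mul_comm_of_mul_comm hdet hBPm)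
  have hY : (1 + Pp * C * Pm)ᴴ = 1 - Pm * C * Pp := by
    rw [← Matrix.star_eq_conjTranspose]
    exact DressedCorePosDef.star_dressing hPpH hPmH hC
  have h := hK.mul_mul_conjTranspose_same (1 + Pp * C * Pm)
  rwa [hY] at h

/-- **The dressed core, its explicit inverse and the operator bound.**  For complementary Hermitian projections `P±`,
a positive definite `B` commuting with them and an anti-Hermitian `C`, the core
`M = (1 + P⁺CP⁻)(BP⁺ + B⁻¹P⁻)(1 − P⁻CP⁺)` has the left inverse `N = (1 + P⁻CP⁺)(BP⁻ + B⁻¹P⁺)(1 − P⁺CP⁻)` and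
`M + N − B ⪰ 0`. -/
theorem core_inv_and_gap (hsum : Pp + Pm = 1) (hPp2 : Pp * Pp = Pp) (hPm2 : Pm * Pm = Pm)
    (hPpPm : Pp * Pm = 0) (hPmPp : Pm * Pp = 0) (hPpH : Pp.IsHermitian) (hPmH : Pm.IsHermitian)
    (hBPp : B * Pp = Pp * B) (hBPm : B * Pm = Pm * B) (hC : Cᴴ = -C) (hB : B.PosDef) :
    (1 + Pm * C * Pp) * (B * Pm + B⁻¹ * Pp) * (1 - Pp * C * Pm) *
          ((1 + Pp * C * Pm) * (B * Pp + B⁻¹ * Pm) * (1 - Pm * C * Pp)) = 1 ∧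
      ((1 + Pp * C * Pm) * (B * Pp + B⁻¹ * Pm) * (1 - Pm * C * Pp) +
          (1 + Pm * C * Pp) * (B * Pm + B⁻¹ * Pp) * (1 - Pp * C * Pm) - B).PosSemidef := by
  have hdet : IsUnit B.det := (Matrix.isUnit_iff_isUnit_det B).mp hB.isUnit
  refine ⟨?_, ?_⟩
  · have h1 : (1 - Pp * C * Pm) * (1 + Pp * C * Pm) = 1 := one_sub_mul_one_add (dressing_sq C hPmPp)
    have h2 : (B * Pm + B⁻¹ * Pp) * (B * Pp + B⁻¹ * Pm) = 1 :=
      kernel'_mul_kernel hdet hsum hPp2 hPm2 hPpPm hPmPp hBPp hBPm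
    have h3 : (1 + Pm * C * Pp) * (1 - Pm * C * Pp) = 1 := one_add_mul_one_sub (dressing_sq C hPpPm)
    calc (1 + Pm * C * Pp) * (B * Pm + B⁻¹ * Pp) * (1 - Pp * C * Pm) *
          ((1 + Pp * C * Pm) * (B * Pp + B⁻¹ * Pm) * (1 - Pm * C * Pp))
          = (1 + Pm * C * Pp) * ((B * Pm + B⁻¹ * Pp) * ((1 - Pp * C * Pm) * (1 + Pp * C * Pm)) *
              (B * Pp + B⁻¹ * Pm)) * (1 - Pm * C * Pp) := by simp only [Matrix.mul_assoc]
      _ = 1 := by rw [h1, Matrix.mul_one, h2, Matrix.mul_one, h3]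
  · rw [core_eq C hPpPm hPmPp hBPm, core_eq C hPmPp hPpPm hBPp]
    have hB' : B * Pp + B * Pm = B := by rw [← Matrix.mul_add, hsum, Matrix.mul_one]
    have e : B * Pp + (1 + Pp * C * Pm) * (B⁻¹ * Pm) * (1 - Pm * C * Pp) +
          (B * Pm + (1 + Pm * C * Pp) * (B⁻¹ * Pp) * (1 - Pp * C * Pm)) - B =
        (1 + Pp * C * Pm) * (B⁻¹ * Pm) * (1 - Pm * C * Pp) +
          (1 + Pm * C * Pp) * (B⁻¹ * Pp) * (1 - Pp * C * Pm) := by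
      calc _ = (1 + Pp * C * Pm) * (B⁻¹ * Pm) * (1 - Pm * C * Pp) +
            (1 + Pm * C * Pp) * (B⁻¹ * Pp) * (1 - Pp * C * Pm) + (B * Pp + B * Pm - B) := by abel
        _ = _ := by rw [hB', sub_self, add_zero]
    rw [e]
    exact (tail_posSemidef hPm2 hPpH hPmH hBPm hC hB).add (tail_posSemidef hPp2 hPmH hPpH hBPp hC hB)

omit [Fintype n] [DecidableEq n] in
/-- Chaining two operator inequalities: `X − B ⪰ 0` and `B − T ⪰ 0` give `X − T ⪰ 0`. -/
theorem posSemidef_sub_trans {X B T : Matrix n n ℂ} (h1 : (X - B).PosSemidef) (h2 : (B - T).PosSemidef) :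
    (X - T).PosSemidef := by
  have e : X - T = X - B + (B - T) := by abel
  rw [e]
  exact h1.add h2

/-- **Eigenvalue form of `M + M⁻¹ ⪰ β`.**  If `M v = μ v` (`μ > 0`, `vᴴv = 1`), `N M = 1` and `M + N − β·1 ⪰ 0`,
then `β ≤ μ + 1/μ`. -/
theorem le_of_eigenvector {M N : Matrix n n ℂ} {v : n → ℂ} {μ β : ℝ} (hμ : 0 < μ)
    (hMv : M *ᵥ v = (μ : ℂ) • v) (hNM : N * M = 1) (hvv : star v ⬝ᵥ v = 1)
    (hT : (M + N - (β : ℂ) • (1 : Matrix n n ℂ)).PosSemidef) : β ≤ μ + μ⁻¹ := by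
  have hμne : (μ : ℂ) ≠ 0 := Complex.ofReal_ne_zero.mpr hμ.ne'
  have hNv : N *ᵥ v = (μ : ℂ)⁻¹ • v := by
    have h : N *ᵥ (M *ᵥ v) = v := by rw [Matrix.mulVec_mulVec, hNM, Matrix.one_mulVec]
    rw [hMv, Matrix.mulVec_smul] at h
    have h2 := congrArg (fun w : n → ℂ => (μ : ℂ)⁻¹ • w) h
    simp only [smul_smul, inv_mul_cancel₀ hμne, one_smul] at h2
    exact h2
  have hTv : (M + N - (β : ℂ) • (1 : Matrix n n ℂ)) *ᵥ v = ((μ : ℂ) + (μ : ℂ)⁻¹ - (β : ℂ)) • v := by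
    rw [Matrix.sub_mulVec, Matrix.add_mulVec, hMv, hNv, Matrix.smul_mulVec, Matrix.one_mulVec, sub_smul, add_smul]
  have hq := hT.dotProduct_mulVec_nonneg v
  rw [hTv, dotProduct_smul, smul_eq_mul, hvv, mul_one] at hq
  have h3 : (0 : ℝ) ≤ μ + μ⁻¹ - β := by
    rw [← Complex.zero_le_real]
    push_cast
    exact hq
  linarith

/-- **Every eigenvalue `μ` of a positive `M` with `N M = 1` and `M + N ⪰ β·1` satisfies `β ≤ μ + 1/μ`.** -/
theorem le_eigenvalue_add_inv {M N : Matrix n n ℂ} (hM : M.PosDef) (hNM : N * M = 1) {β : ℝ}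
    (hT : (M + N - (β : ℂ) • (1 : Matrix n n ℂ)).PosSemidef) (i : n) :
    β ≤ hM.1.eigenvalues i + (hM.1.eigenvalues i)⁻¹ := by
  refine le_of_eigenvector (v := ⇑(hM.1.eigenvectorBasis i)) (hM.eigenvalues_pos i) ?_ hNM ?_ hT
  · rw [hM.1.mulVec_eigenvectorBasis i]
    ext j
    simp only [Pi.smul_apply, Complex.real_smul, smul_eq_mul]
  · have h1 : inner ℂ (hM.1.eigenvectorBasis i) (hM.1.eigenvectorBasis i) = (1 : ℂ) := by
      rw [inner_self_eq_norm_sq_to_K, hM.1.eigenvectorBasis.orthonormal.1 i]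
      simp
    rwa [EuclideanSpace.inner_eq_star_dotProduct, dotProduct_comm] at h1

/-- Elementary: for `μ > 0` with `μ + 1/μ ≥ 17/4` (i.e. `μ ∉ (1/4, 4)`) and every `k`,
`log(1 + μ^k) ≤ k·log max(μ, 1) + (1/4)^k`. -/
theorem log_one_add_pow_le_of_gap {μ : ℝ} (hμ : 0 < μ) (hgap : 17 / 4 ≤ μ + μ⁻¹) (k : ℕ) :
    Real.log (1 + μ ^ k) ≤ k * Real.log (max μ 1) + (1 / 4 : ℝ) ^ k := by
  have key : μ ≤ 1 / 4 ∨ 4 ≤ μ := by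
    rcases le_or_gt μ (1 / 4) with hle | hgt
    · exact Or.inl hle
    rcases le_or_gt 4 μ with hge | hlt
    · exact Or.inr hge
    exfalso
    have h1 : (μ - 4) * (μ - 1 / 4) < 0 := mul_neg_of_neg_of_pos (by linarith) (by linarith)
    have h2 : 17 / 4 * μ ≤ (μ + μ⁻¹) * μ := mul_le_mul_of_nonneg_right hgap hμ.le
    have h3 : (μ + μ⁻¹) * μ = μ ^ 2 + 1 := by rw [add_mul, inv_mul_cancel₀ hμ.ne']; ring
    nlinarith
  rcases key with hle | hge
  · -- a small eigenvalue: `μ ≤ 1/4`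
    have hμ1 : μ ≤ 1 := by linarith
    rw [max_eq_right hμ1, Real.log_one, mul_zero, zero_add]
    calc Real.log (1 + μ ^ k) ≤ μ ^ k := by
          have := Real.log_le_sub_one_of_pos (show 0 < 1 + μ ^ k by positivity); linarith
      _ ≤ (1 / 4) ^ k := pow_le_pow_left₀ hμ.le hle k
  · -- a large eigenvalue: `4 ≤ μ`
    have hμ1 : 1 ≤ μ := by linarith
    rw [max_eq_left hμ1]
    have hfac : 1 + μ ^ k = μ ^ k * (1 + μ⁻¹ ^ k) := by
      rw [mul_add, mul_one, ← mul_pow, mul_inv_cancel₀ hμ.ne', one_pow, add_comm]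
    rw [hfac, Real.log_mul (pow_ne_zero k hμ.ne') (by positivity), Real.log_pow]
    have hinv : μ⁻¹ ≤ 1 / 4 := by
      calc μ⁻¹ ≤ 4⁻¹ := inv_anti₀ (by norm_num) hge
        _ = 1 / 4 := by norm_num
    have hlog : Real.log (1 + μ⁻¹ ^ k) ≤ (1 / 4) ^ k :=
      calc Real.log (1 + μ⁻¹ ^ k) ≤ μ⁻¹ ^ k := by
            have := Real.log_le_sub_one_of_pos (show 0 < 1 + μ⁻¹ ^ k by positivity); linarith
        _ ≤ (1 / 4) ^ k := pow_le_pow_left₀ (inv_pos.mpr hμ).le hinv k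
    linarith

end Abstract

/-! ### The slice data: `B̂ ⪰ (M_ω − 1)·1` and the eigenvalue gap of `oneStepR` -/

/-- **The spin-blind slice operator dominates `(M_ω − 1)·1`**: `B̂_t − (m + 4 − cos ω₀ − cos ω₁ − 1)·1 ⪰ 0`, since
`B_t = (M_ω − 1)·1 + ½(1 − H_t)ᴴ(1 − H_t)` with the isometric hop `H_t`. -/
theorem sliceBhR_sub_smul_one_posSemidef {L₁ L₂ : ℕ} [NeZero L₁] [NeZero L₂]
    (A : ZMod L₁ → ZMod L₂ → Fin 4 → Matrix.unitaryGroup (Fin 3) ℂ) (m ω₀ ω₁ : ℝ) (t : ZMod L₁) :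
    (sliceBhR A m ω₀ ω₁ t - ((m + 4 - Real.cos ω₀ - Real.cos ω₁ - 1 : ℝ) : ℂ) •
      (1 : Matrix (ZMod L₂ × Fin 3 × Fin 4) (ZMod L₂ × Fin 3 × Fin 4) ℂ)).PosSemidef := by
  have hmass : massHopR A m ω₀ ω₁ t = Matrix.diagonal (fun _ => ((m + 4 - Real.cos ω₀ - Real.cos ω₁ - 1 : ℝ) : ℂ)) +
      (1 / 2 : ℂ) • ((1 - hop3R A t)ᴴ * (1 - hop3R A t)) := by
    have h := SliceMassHopPosDef.diagonal_sub_hopSum_eq (fun _ : Fin 1 => hop3R A t)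
      (fun _ => conjTranspose_mul_hop3R A t) (fun _ : ZMod L₂ × Fin 3 => m + 4 - Real.cos ω₀ - Real.cos ω₁)
    rw [Fin.sum_univ_one, Fin.sum_univ_one, Fintype.card_fin, Nat.cast_one] at h
    exact h
  have hhalf : (0 : ℂ) ≤ 1 / 2 := by
    rw [show (1 / 2 : ℂ) = ((1 / 2 : ℝ) : ℂ) by norm_num]
    exact Complex.zero_le_real.2 (by norm_num)
  have hR : (Matrix.reindexAlgEquiv ℂ ℂ (Equiv.prodAssoc (ZMod L₂) (Fin 3) (Fin 4))
      (((1 / 2 : ℂ) • ((1 - hop3R A t)ᴴ * (1 - hop3R A t))) ⊗ₖ (1 : Matrix (Fin 4) (Fin 4) ℂ))).PosSemidef := by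
    rw [Matrix.coe_reindexAlgEquiv, Matrix.reindex_apply]
    exact (((Matrix.posSemidef_conjTranspose_mul_self (1 - hop3R A t)).smul hhalf).kronecker
      Matrix.PosSemidef.one).submatrix _
  have hBh : sliceBhR A m ω₀ ω₁ t = ((m + 4 - Real.cos ω₀ - Real.cos ω₁ - 1 : ℝ) : ℂ) •
        (1 : Matrix (ZMod L₂ × Fin 3 × Fin 4) (ZMod L₂ × Fin 3 × Fin 4) ℂ) +
      Matrix.reindexAlgEquiv ℂ ℂ (Equiv.prodAssoc (ZMod L₂) (Fin 3) (Fin 4))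
        (((1 / 2 : ℂ) • ((1 - hop3R A t)ᴴ * (1 - hop3R A t))) ⊗ₖ (1 : Matrix (Fin 4) (Fin 4) ℂ)) := by
    unfold sliceBhR
    rw [hmass, Matrix.add_kronecker, map_add, ← Matrix.smul_one_eq_diagonal, Matrix.smul_kronecker,
      Matrix.one_kronecker_one, map_smul, map_one]
  rw [hBh, add_sub_cancel_left]
  exact hR

/-- **The eigenvalue gap of the one-step matrix**: for every field `A`, `m > −1` and every row `t`, every eigenvalue `μ`
of the positive matrix `M_t = oneStepR A m ω₀ ω₁ t` satisfies `m + 4 − cos ω₀ − cos ω₁ − 1 ≤ μ + 1/μ`. -/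
theorem oneStepR_eigenvalue_gap {L₁ L₂ : ℕ} [NeZero L₁] [NeZero L₂]
    (A : ZMod L₁ → ZMod L₂ → Fin 4 → Matrix.unitaryGroup (Fin 3) ℂ) {m : ℝ} (hm : -1 < m) (ω₀ ω₁ : ℝ) (t : ZMod L₁)
    (hM : (oneStepR A m ω₀ ω₁ t).PosDef) (i : ZMod L₂ × Fin 3 × Fin 4) :
    m + 4 - Real.cos ω₀ - Real.cos ω₁ - 1 ≤ hM.1.eigenvalues i + (hM.1.eigenvalues i)⁻¹ := by
  have hsum : projP L₂ + projM L₂ = 1 := liftProjPlus_add_liftProjMinus (ZMod L₂) 3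
  have hPQ : projP L₂ * projM L₂ = 0 := liftProjPlus_mul_liftProjMinus (ZMod L₂) 3
  have hQP : projM L₂ * projP L₂ = 0 := liftProjMinus_mul_liftProjPlus (ZMod L₂) 3
  have hPP : projP L₂ * projP L₂ = projP L₂ := WilsonTransfer.mul_self_of_add_eq_one hsum hPQ
  have hQQ : projM L₂ * projM L₂ = projM L₂ := WilsonTransfer.mul_self_of_add_eq_one ((add_comm _ _).trans hsum) hQP
  obtain ⟨-, hBQ, hBP, -⟩ := slice_spin_structureR A m ω₀ ω₁ t
  obtain ⟨-, hC, hPh, hQh, hBpos⟩ := slice_claimsR A hm ω₀ ω₁ t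
  obtain ⟨hNM, hcore⟩ := core_inv_and_gap hsum hPP hQQ hPQ hQP hPh hQh hBP hBQ hC hBpos
  have hT := posSemidef_sub_trans hcore (sliceBhR_sub_smul_one_posSemidef A m ω₀ ω₁ t)
  exact le_eigenvalue_add_inv hM hNM hT i

/-- **Finite-length pressure bound from the gap**: if `17/4 ≤ m + 4 − cos ω₀ − cos ω₁ − 1` then
`log det(1 + M_t^k) ≤ k Σᵢ log max(μᵢ, 1) + 12 L₂ (1/4)^k`. -/
theorem log_det_one_add_pow_le {L₁ L₂ : ℕ} [NeZero L₁] [NeZero L₂]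
    (A : ZMod L₁ → ZMod L₂ → Fin 4 → Matrix.unitaryGroup (Fin 3) ℂ) {m : ℝ} (hm : -1 < m) (ω₀ ω₁ : ℝ) (t : ZMod L₁)
    (hheavy : 17 / 4 ≤ m + 4 - Real.cos ω₀ - Real.cos ω₁ - 1) (k : ℕ) (hM : (oneStepR A m ω₀ ω₁ t).PosDef) :
    Real.log ((1 + oneStepR A m ω₀ ω₁ t ^ k).det).re ≤
      k * (∑ i, Real.log (max (hM.1.eigenvalues i) 1)) + 12 * L₂ * (1 / 4 : ℝ) ^ k := by
  have hdet := det_one_add_pow_eq (oneStepR A m ω₀ ω₁ t) hM.posSemidef k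
  have hre : ((1 + oneStepR A m ω₀ ω₁ t ^ k).det).re = ∏ i, (1 + hM.1.eigenvalues i ^ k) := by
    rw [hdet, ← Complex.ofReal_prod, Complex.ofReal_re]
  have hpos : ∀ i, 0 < hM.1.eigenvalues i := fun i => hM.eigenvalues_pos i
  have hgap : ∀ i, 17 / 4 ≤ hM.1.eigenvalues i + (hM.1.eigenvalues i)⁻¹ := fun i =>
    hheavy.trans (oneStepR_eigenvalue_gap A hm ω₀ ω₁ t hM i)
  rw [hre, Real.log_prod]
  · calc ∑ i, Real.log (1 + hM.1.eigenvalues i ^ k)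
          ≤ ∑ i, ((k : ℝ) * Real.log (max (hM.1.eigenvalues i) 1) + (1 / 4 : ℝ) ^ k) :=
            Finset.sum_le_sum fun i _ => log_one_add_pow_le_of_gap (hpos i) (hgap i) k
      _ = k * ∑ i, Real.log (max (hM.1.eigenvalues i) 1) +
            (Fintype.card (ZMod L₂ × Fin 3 × Fin 4) : ℝ) * (1 / 4 : ℝ) ^ k := by
            rw [Finset.sum_add_distrib, Finset.mul_sum, Finset.sum_const, nsmul_eq_mul, Finset.card_univ]
      _ = k * ∑ i, Real.log (max (hM.1.eigenvalues i) 1) + 12 * L₂ * (1 / 4 : ℝ) ^ k := by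
            rw [Fintype.card_prod, Fintype.card_prod, ZMod.card, Fintype.card_fin, Fintype.card_fin]
            push_cast
            ring
  · intro i _
    exact (lt_of_lt_of_le zero_lt_one (le_add_of_nonneg_right (pow_nonneg (hpos i).le k))).ne'

end FreeGap

/-! ### Registered stub -/

open FrequencyDiamagnetism in
/-- **Stub `freeGap`** (Route B of line `Sketch`): the FREE one-step transfer matrix of the free row on the slice space
`ℤ/L₂ × colour × spin` at a heavy frequency (`|m| ≤ 1/10`, `cos ω₀, cos ω₁ ≤ −199/200`) has no eigenvalue in `(1/4, 4)`
(`μ + 1/μ ≥ M_ω − 1 ≥ 4.89`), whence the finite-length pressure is exponentially close to `k · p(M_f)` from above: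
`log det(1 + M_f^k) ≤ k Σᵢ log max(μᵢ, 1) + 12 L₂ (1/4)^k`. -/
theorem freeGap : ∀ (L₂ : ℕ) [NeZero L₂] (m : ℝ), |m| ≤ 1 / 10 → ∀ ω₀ ω₁ : ℝ, Real.cos ω₀ ≤ -(199 / 200) → Real.cos ω₁ ≤ -(199 / 200) → ∀ (k : ℕ), 0 < k → ∀ hM : (oneStepR (fun (_ : ZMod 1) (_ : ZMod L₂) (_ : Fin 4) => (1 : Matrix.unitaryGroup (Fin 3) ℂ)) m ω₀ ω₁ 0).PosDef, Real.log ((1 + oneStepR (fun (_ : ZMod 1) (_ : ZMod L₂) (_ : Fin 4) => (1 : Matrix.unitaryGroup (Fin 3) ℂ)) m ω₀ ω₁ 0 ^ k).det).re ≤ k * (∑ i, Real.log (max (hM.1.eigenvalues i) 1)) + 12 * L₂ * (1 / 4 : ℝ) ^ k := by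
  intro L₂ _ m hm ω₀ ω₁ hω₀ hω₁ k _ hM
  have hm' := abs_le.mp hm
  exact FreeGap.log_det_one_add_pow_le _ (by linarith [hm'.1]) ω₀ ω₁ 0 (by linarith [hm'.1]) k hM

end Summit.QuantumFields.QCD.Cruxes.CriticalLineDiamagnetism.ChessboardCellGain

end
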